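import Summits.BirchSwinnertonDyer.Rank1Residual.Additive.RamifiedSevenGenusPartnerTransport
import Literature.NumberTheory.EllipticCurves.Kato2004.IwasawaCohomologyEulerSystemLift
import HarnessLib

/-!
# The realisation datum (A4) of F-P1 for the transported `ℚ`-side pin

Pen D1126 (R-a) / D1128 / D1133 (row (T5)/(T6) input), route `K7r`, crux `stmt-BirchSwinnertonDyer-19945`; companion of
`RamifiedSevenGenusPartnerTransport.lean` ((T1)–(T3), p823222) and `RamifiedSevenGenusPartnerTransportRes.lean` ((T4), p823364).

F-P1 (`Literature/…/Kato2004/EllipticUnitZetaClassComparison.lean`, `CM.kato15161_ellipticUnitClass_res_zetaFamily`) asks, at the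
maximal-order partner `W₂`, for the realisation datum (A4) «`I₂.proj n y = levelToLayer W₂ p hκ hp S n (z₂ (n + 1) 𝟙)`» of a
`ℚ`-side pin `I₂ : IwasawaH1Data W₂ p κ γ`.  For the TRANSPORTED pin `I₂ := PartnerTransport.transportQ I β α …` (carrier `I.H`,
`proj₂ := β_* ∘ proj`) and the transported family `z₂ := β_* ∘ z` it is the member's own (A4) pushed through ONE naturality,
`β_* ∘ Cor = Cor ∘ β_*` for the corestriction `levelToLayer = coresLe` from the Euler-system level `ℚ(μ_{p^{n+1}})` to the layer `ℚ_n`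
(`isogenyMapH1_coresLe`).  General `W, W₂ / ℚ`, prime `p ≠ 2`, cyclotomic `κ`.

## Contents
* `isogenyMapH1_levelToLayer` — `β_* (levelToLayer W … c) = levelToLayer W₂ … (β_* c)`.
* ★ `transportQ_proj_eq_levelToLayer` — (A4) for `transportQ I β α …` and `z₂ := β_* z` from (A4) for `I` and `z`.

References: Serre, *Galois Cohomology*, I §2.4 (functoriality of `cor`); Kato, Astérisque 295, §13.1 and Thm. 13.4 (pp. 224–226);
Rubin, *Euler Systems*, App. B §3.
-/

set_option autoImplicit false

noncomputable section

open scoped NumberField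
open Field IsDedekindDomain NumberField WeierstrassCurve
open Literature.NumberTheory.GaloisRepresentations
open Literature.NumberTheory.EllipticCurves
open Literature.NumberTheory.EllipticCurves.Kato2004
open Literature.NumberTheory.EllipticCurves.Kato2004.EulerSystemValues (tateRep)

namespace Summit.BirchSwinnertonDyer.Rank1Residual.Additive.GenusSeven

namespace PartnerTransport

variable {W W₂ : WeierstrassCurve ℚ} [W.IsElliptic] [W₂.IsElliptic] {p : ℕ} [Fact p.Prime]
  [ContinuousSMul ℤ_[p] (W.tateModule p)] [ContinuousSMul ℤ_[p] (W₂.tateModule p)]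
  {κ : ZpExtension ℚ p} (hκ : κ.IsCyclotomic) (hp : p ≠ 2)

/-- **`β_*` commutes with `levelToLayer`** (the corestriction `Cor : H¹(ℚ(μ_{p^{n+1}}), T) → H¹(ℚ_n, T)` is natural in the
coefficients: `levelToLayer = coresLe`, `isogenyMapH1_coresLe`). [cite: SerreGaloisCohomology1997, I §2.4] -/
theorem isogenyMapH1_levelToLayer (β : Isogeny W W₂) (S : Set (HeightOneSpectrum (𝓞 ℚ))) (n : ℕ)
    (c : H1 (tateRep W p) ((cyclotomicLevelsRat p S).level (n + 1) ∅)) :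
    isogenyMapH1 p β (κ.layerSubgroup n) (levelToLayer W p hκ hp S n c) =
      levelToLayer W₂ p hκ hp S n (isogenyMapH1 p β ((cyclotomicLevelsRat p S).level (n + 1) ∅) c) := by
  haveI : ((cyclotomicLevelsRat p S).level (n + 1) ∅).FiniteIndex :=
    finiteIndex_of_isOpen_of_compactSpace _ ((cyclotomicLevelsRat p S).isOpen_level (n + 1) ∅)
  letI : Fintype (κ.layerSubgroup n ⧸ ((cyclotomicLevelsRat p S).level (n + 1) ∅).subgroupOf (κ.layerSubgroup n)) :=
    Fintype.ofFinite _
  exact isogenyMapH1_coresLe p β _ _ c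

/-- ★ **(A4) for the transported pin.** If `y ∈ I.H` realises the family `z` on the member (`I.proj n y = Cor (z_{n+1})` for
all `n`), then the same `y`, read in `I₂ := transportQ I β α …`, realises the transported family `β_* z` on the partner:
`I₂.proj n y = Cor (β_* z_{n+1})` (`transportQ_proj` + `isogenyMapH1_levelToLayer`).
[cite: Kato2004Asterisque, §13.1 and Thm. 13.4 (pp. 224–226)] [cite: Rubin2000, App. B §3] -/
theorem transportQ_proj_eq_levelToLayer {γ : absoluteGaloisGroup ℚ} (I : IwasawaH1Data W p κ γ)
    (β : Isogeny W W₂) (α : Isogeny W₂ W) (e : ℤ) (u : ℤ_[p]ˣ) (hu : (u : ℤ_[p]) = e)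
    (hαβ : ∀ P, α (β P) = e • P) (hβα : ∀ P, β (α P) = e • P)
    (S : Set (HeightOneSpectrum (𝓞 ℚ))) (zz : ∀ n : ℕ, H1 (tateRep W p) ((cyclotomicLevelsRat p S).level (n + 1) ∅))
    {y : I.H} (hy : ∀ n : ℕ, I.proj n y = levelToLayer W p hκ hp S n (zz n)) (n : ℕ) :
    (transportQ I β α e u hu hαβ hβα).proj n y =
      levelToLayer W₂ p hκ hp S n (isogenyMapH1 p β ((cyclotomicLevelsRat p S).level (n + 1) ∅) (zz n)) := by
  rw [transportQ_proj, hy n, isogenyMapH1_levelToLayer]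

end PartnerTransport

end Summit.BirchSwinnertonDyer.Rank1Residual.Additive.GenusSeven

end
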